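import Mathlib
import HarnessLib
import Summits.AtomisticToContinuum.FouriersLaw.Theses.JunctionLocality
import Summits.AtomisticToContinuum.FouriersLaw.Theorems.JunctionLocalityConductanceLowerBoundCertificatePairingEnergy
import Summits.AtomisticToContinuum.FouriersLaw.Theorems.JunctionLocalityConductanceLowerBoundCertificatePairingSource

/-!
# The two-ends obstruction for floor certificates (crux stmt-AtomisticToContinuum-11749, line `ForecastSensitivitySketch`)

Helper file (`--supports stmt-AtomisticToContinuum-11749`, lead c5).  Setting as in `…CertificatePairingEnergy` / `…Source`:
admissible pairs `(φ, χ)` of the `L`-chain (`L ≥ 2`), `γ S_B φ + X_H χ = −(p_0² − T)`, whose contact Dirichlet cost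
`Σ_{b∈{0,L−1}} (‖∂_{p_b}φ‖² + ‖∂_{p_b}χ‖²)` bounds `E_near(g) + E_far(g)` of the forward field from above (certificate principle,
`…CertificatePrinciple`); the trivial pair `((p_0² − T)/(2γ), 0)` costs `T/γ²` and certifies only `G_L ≥ 0`.

* `sq_integral_momentum_mul_le` — Cauchy–Schwarz `⟨p_i, f⟩² ≤ T ‖f‖²` in `L²(μ_T)`;
* `certificate_loading_reciprocity` — `γ T ⟨p_{L−1}, ∂_{p_{L−1}}φ⟩ = −⟨χ, p_0 ∂_{q_0}H⟩`;
* `certificate_cost_ge_half` — `‖∂_{p_0}φ‖² + ‖∂_{p_{L−1}}φ‖² ≥ T/(2γ²)` (certificate form of the ceiling `G_L ≤ γ/2`);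
* `certificate_noGain_of_farFree` — `∂_{p_{L−1}}φ ≡ 0 ⟹ ‖∂_{p_0}φ‖² ≥ T/γ²`;
* `certificate_noGain_of_reversalEven` — `χ` momentum-reversal-even `⟹ ‖∂_{p_0}φ‖² ≥ T/γ²`.

Hence a certificate that improves on the trivial pair (as the floor requires, with gain `≥ 2c/(L−1)`) must load the FAR thermostat
through `φ` and carry a reversal-ODD `χ` positively correlated with the contact kinetic-energy production `−p_0 ∂_{q_0}H`: it is a
cross-chain transport object (the "admissibility wall" of lead c3's M3 / strategist S4, kernel-checked).  No new definitions, no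
named facts, no sorry.  References: folklore.
-/

noncomputable section

open MeasureTheory Filter Topology
open scoped ContDiff
open Literature.MathematicalPhysics.KineticTheory.HeatConduction
open Summit.AtomisticToContinuum.FouriersLaw.Theorems.SuperadditiveResistance.DeviceLiouville
  (kin kin_eq_sq continuous_kin liouvilleOp bathOp continuous_liouvilleOp continuous_bathOp
    pinnedChain_sq_le_two_mul_hamiltonian)
open Summit.AtomisticToContinuum.FouriersLaw.Theorems.SuperadditiveResistance.Kubo
  (chi contDiff_chi hasCompactSupport_chi tendsto_integral_chi_mul tendsto_integral_partialP_chi_mul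
    integral_chi_mul_bathOp integral_chi_liouville_antisymm
    integrable_mul_mul_gibbsDensity integrable_sq_mul_gibbsDensity memLp_momentum memLp_kinetic memLp_hamiltonian
    integral_kinetic_mul_hamiltonian_mul_gibbsDensity gauss_ibp integral_sq_mul_gibbsDensity_eq
    partialQ_hamiltonian_rev integral_rev_mul_gibbsDensity rev)
open Summit.AtomisticToContinuum.FouriersLaw.Cruxes.SuperadditiveResistance.InsertionToolbox
  (pinnedChain_memLp_two_of_abs_le)

namespace Summit.AtomisticToContinuum.FouriersLaw.Cruxes.ConductanceLowerBound.ForecastSensitivity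

variable {ω₂ lam β γ T : ℝ}


/-! ## §3 Consequences: loading reciprocity, the certificate ceiling, and the two-ends obstruction -/

/-- `∫ p_i² dμ_T = T`. [folklore] -/
theorem integral_momentum_sq_gibbsMeasure (hω : 0 < ω₂) (hl : 0 ≤ lam) (hβ : 0 ≤ β) (hT : 0 < T)
    (L : ℕ) (i : Fin L) : ∫ x, x.2 i ^ 2 ∂((pinnedChain ω₂ lam β γ).gibbsMeasure L T) = T := by
  have hZ : 0 < ∫ x, (pinnedChain ω₂ lam β γ).gibbsDensity L T x :=
    integral_exp_pos (pinnedChain_integrable_gibbsDensity hω hl hβ γ L hT)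
  rw [OscillatorChain.integral_gibbsMeasure, integral_sq_mul_gibbsDensity_eq (γ := γ) hω hl hβ L hT i]
  field_simp

/-- **Cauchy–Schwarz against a contact momentum**: `⟨p_i, f⟩² ≤ T ‖f‖²` in `L²(μ_T)` (`‖p_i‖² = T`; from
`0 ≤ ∫ (⟨p_i,f⟩ p_i − T f)² dμ_T`). [folklore] -/
theorem sq_integral_momentum_mul_le (hω : 0 < ω₂) (hl : 0 ≤ lam) (hβ : 0 ≤ β) (hT : 0 < T)
    (L : ℕ) (i : Fin L) {f : PhaseSpace L → ℝ} (hf : MemLp f 2 ((pinnedChain ω₂ lam β γ).gibbsMeasure L T)) :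
    (∫ x, x.2 i * f x ∂((pinnedChain ω₂ lam β γ).gibbsMeasure L T)) ^ 2 ≤ T * ∫ x, f x ^ 2 ∂((pinnedChain ω₂ lam β γ).gibbsMeasure L T) := by
  set μ := (pinnedChain ω₂ lam β γ).gibbsMeasure L T with hμ
  have hp : MemLp (fun x : PhaseSpace L => x.2 i) 2 μ := memLp_momentum hω hl hβ L hT i
  set A := ∫ x, x.2 i * f x ∂μ with hA
  have hp2 : ∫ x, x.2 i ^ 2 ∂μ = T := integral_momentum_sq_gibbsMeasure hω hl hβ hT L i
  have hI1 : Integrable (fun x => x.2 i ^ 2) μ := hp.integrable_sq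
  have hI2 : Integrable (fun x => x.2 i * f x) μ := hp.integrable_mul hf
  have hI3 : Integrable (fun x => f x ^ 2) μ := hf.integrable_sq
  have hnn : 0 ≤ ∫ x, (A * x.2 i - T * f x) ^ 2 ∂μ := integral_nonneg fun x => sq_nonneg _
  have e : (fun x => (A * x.2 i - T * f x) ^ 2) =
      fun x => A ^ 2 * x.2 i ^ 2 - 2 * A * T * (x.2 i * f x) + T ^ 2 * f x ^ 2 := by
    funext x; ring
  have s1 : ∫ x, A ^ 2 * x.2 i ^ 2 - 2 * A * T * (x.2 i * f x) + T ^ 2 * f x ^ 2 ∂μ =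
      (∫ x, A ^ 2 * x.2 i ^ 2 - 2 * A * T * (x.2 i * f x) ∂μ) + ∫ x, T ^ 2 * f x ^ 2 ∂μ :=
    integral_add ((hI1.const_mul _).sub (hI2.const_mul _)) (hI3.const_mul _)
  have s2 : ∫ x, A ^ 2 * x.2 i ^ 2 - 2 * A * T * (x.2 i * f x) ∂μ =
      (∫ x, A ^ 2 * x.2 i ^ 2 ∂μ) - ∫ x, 2 * A * T * (x.2 i * f x) ∂μ :=
    integral_sub (hI1.const_mul _) (hI2.const_mul _)
  rw [e, s1, s2, integral_const_mul, integral_const_mul, integral_const_mul, hp2, ← hA] at hnn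
  nlinarith [hnn, hT]

/-- **Loading reciprocity.**  For `L ≥ 2` and every admissible pair `(φ, χ)` with `χ ∈ L²(μ_T)`:
`γ T ⟨p_{L−1}, ∂_{p_{L−1}}φ⟩_{μ_T} = −⟨χ, p_0 ∂_{q_0}H⟩_{μ_T}` — the `φ`-component loads the FAR thermostat exactly as much
as the `χ`-component correlates with the kinetic-energy production `X_H(p_0²/2) = −p_0 ∂_{q_0}H` at the NEAR contact
(difference of the two pairing identities). [folklore] -/
theorem certificate_loading_reciprocity (hω : 0 < ω₂) (hl : 0 ≤ lam) (hβ : 0 ≤ β) (hT : 0 < T)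
    {L : ℕ} (hL : 2 ≤ L) {φ χ : PhaseSpace L → ℝ} (hφ : ContDiff ℝ 2 φ) (hχ : ContDiff ℝ 2 χ)
    (hφ0 : MemLp (partialP (⟨0, by omega⟩ : Fin L) φ) 2 ((pinnedChain ω₂ lam β γ).gibbsMeasure L T))
    (hφR : MemLp (partialP (⟨L - 1, by omega⟩ : Fin L) φ) 2 ((pinnedChain ω₂ lam β γ).gibbsMeasure L T))
    (hχ2 : MemLp χ 2 ((pinnedChain ω₂ lam β γ).gibbsMeasure L T))
    (hpair : ∀ x, γ * bathOp L (OscillatorChain.bathWeight L) T φ x +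
      liouvilleOp (pinnedChain ω₂ lam β γ) L χ x = -(kin L 0 x - T)) :
    γ * T * ∫ x, x.2 ⟨L - 1, by omega⟩ * partialP (⟨L - 1, by omega⟩ : Fin L) φ x ∂((pinnedChain ω₂ lam β γ).gibbsMeasure L T) =
      -∫ x, χ x * (x.2 ⟨0, by omega⟩ * partialQ (⟨0, by omega⟩ : Fin L) ((pinnedChain ω₂ lam β γ).hamiltonian L) x)
        ∂((pinnedChain ω₂ lam β γ).gibbsMeasure L T) := by
  have h1 := certificate_pairing_hamiltonian hω hl hβ hT hL hφ hχ hφ0 hφR hpair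
  have h2 := certificate_pairing_source hω hl hβ hT hL hφ hχ hφ0 hφR hχ2 hpair
  have h1' : γ * T * ((∫ x, x.2 ⟨0, by omega⟩ * partialP (⟨0, by omega⟩ : Fin L) φ x ∂((pinnedChain ω₂ lam β γ).gibbsMeasure L T)) +
      ∫ x, x.2 ⟨L - 1, by omega⟩ * partialP (⟨L - 1, by omega⟩ : Fin L) φ x ∂((pinnedChain ω₂ lam β γ).gibbsMeasure L T)) =
      T ^ 2 := by
    rw [mul_assoc γ T, mul_left_comm, h1]; ring
  linarith

/-- **Certificate ceiling.**  For `L ≥ 2` every admissible pair `(φ, χ)` has contact Dirichlet cost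
`‖∂_{p_0}φ‖² + ‖∂_{p_{L−1}}φ‖² ≥ T/(2γ²)` in `L²(μ_T)` — the certificate form of the landed ceiling `G_L ≤ γ/2`
(`response_le_half_gamma`): from `γ(⟨p_0,∂_{p_0}φ⟩ + ⟨p_{L−1},∂_{p_{L−1}}φ⟩) = T` and Cauchy–Schwarz. [folklore] -/
theorem certificate_cost_ge_half (hω : 0 < ω₂) (hl : 0 ≤ lam) (hβ : 0 ≤ β) (hγ : 0 < γ) (hT : 0 < T)
    {L : ℕ} (hL : 2 ≤ L) {φ χ : PhaseSpace L → ℝ} (hφ : ContDiff ℝ 2 φ) (hχ : ContDiff ℝ 2 χ)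
    (hφ0 : MemLp (partialP (⟨0, by omega⟩ : Fin L) φ) 2 ((pinnedChain ω₂ lam β γ).gibbsMeasure L T))
    (hφR : MemLp (partialP (⟨L - 1, by omega⟩ : Fin L) φ) 2 ((pinnedChain ω₂ lam β γ).gibbsMeasure L T))
    (hpair : ∀ x, γ * bathOp L (OscillatorChain.bathWeight L) T φ x +
      liouvilleOp (pinnedChain ω₂ lam β γ) L χ x = -(kin L 0 x - T)) :
    T / (2 * γ ^ 2) ≤
      (∫ x, (partialP (⟨0, by omega⟩ : Fin L) φ x) ^ 2 ∂((pinnedChain ω₂ lam β γ).gibbsMeasure L T)) +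
        ∫ x, (partialP (⟨L - 1, by omega⟩ : Fin L) φ x) ^ 2 ∂((pinnedChain ω₂ lam β γ).gibbsMeasure L T) := by
  have h1 := certificate_pairing_hamiltonian hω hl hβ hT hL hφ hχ hφ0 hφR hpair
  have c0 := sq_integral_momentum_mul_le hω hl hβ hT L (⟨0, by omega⟩ : Fin L) hφ0
  have cR := sq_integral_momentum_mul_le hω hl hβ hT L (⟨L - 1, by omega⟩ : Fin L) hφR
  set A := ∫ x, x.2 ⟨0, by omega⟩ * partialP (⟨0, by omega⟩ : Fin L) φ x ∂((pinnedChain ω₂ lam β γ).gibbsMeasure L T) with hA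
  set A' := ∫ x, x.2 ⟨L - 1, by omega⟩ * partialP (⟨L - 1, by omega⟩ : Fin L) φ x ∂((pinnedChain ω₂ lam β γ).gibbsMeasure L T)
    with hA'
  set E := ∫ x, (partialP (⟨0, by omega⟩ : Fin L) φ x) ^ 2 ∂((pinnedChain ω₂ lam β γ).gibbsMeasure L T) with hE
  set E' := ∫ x, (partialP (⟨L - 1, by omega⟩ : Fin L) φ x) ^ 2 ∂((pinnedChain ω₂ lam β γ).gibbsMeasure L T) with hE'
  -- T² = γ²(A + A')² ≤ 2γ²(A² + A'²) ≤ 2γ²T(E + E')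
  have hsq : T ^ 2 ≤ 2 * γ ^ 2 * (T * (E + E')) := by
    have e : T ^ 2 = γ ^ 2 * (A + A') ^ 2 := by rw [← h1]; ring
    nlinarith [e, c0, cR, sq_nonneg (A - A'), sq_nonneg γ]
  rw [div_le_iff₀ (by positivity)]
  nlinarith [hsq, hT]

/-- **Two-ends obstruction, far end.**  If the `φ`-component of an admissible pair does not load the far
thermostat (`∂_{p_{L−1}} φ ≡ 0`, e.g. `φ` does not depend on `p_{L−1}`), then `‖∂_{p_0} φ‖²_{L²(μ_T)} ≥ T/γ²`:
the pair costs at least the trivial pair `((p_0² − T)/(2γ), 0)`, i.e. certifies nothing beyond `G_L ≥ 0`.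
(From `γ⟨p_0, ∂_{p_0}φ⟩ = T` and Cauchy–Schwarz.) [folklore] -/
theorem certificate_noGain_of_farFree (hω : 0 < ω₂) (hl : 0 ≤ lam) (hβ : 0 ≤ β) (hγ : 0 < γ) (hT : 0 < T)
    {L : ℕ} (hL : 2 ≤ L) {φ χ : PhaseSpace L → ℝ} (hφ : ContDiff ℝ 2 φ) (hχ : ContDiff ℝ 2 χ)
    (hφ0 : MemLp (partialP (⟨0, by omega⟩ : Fin L) φ) 2 ((pinnedChain ω₂ lam β γ).gibbsMeasure L T))
    (hfar : ∀ x, partialP (⟨L - 1, by omega⟩ : Fin L) φ x = 0)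
    (hpair : ∀ x, γ * bathOp L (OscillatorChain.bathWeight L) T φ x +
      liouvilleOp (pinnedChain ω₂ lam β γ) L χ x = -(kin L 0 x - T)) :
    T / γ ^ 2 ≤ ∫ x, (partialP (⟨0, by omega⟩ : Fin L) φ x) ^ 2 ∂((pinnedChain ω₂ lam β γ).gibbsMeasure L T) := by
  haveI := pinnedChain_isProbabilityMeasure_gibbsMeasure hω hl hβ γ L hT
  have hφR : MemLp (partialP (⟨L - 1, by omega⟩ : Fin L) φ) 2 ((pinnedChain ω₂ lam β γ).gibbsMeasure L T) := by
    have : partialP (⟨L - 1, by omega⟩ : Fin L) φ = fun _ => 0 := funext hfar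
    rw [this]; exact memLp_const 0
  have h1 := certificate_pairing_hamiltonian hω hl hβ hT hL hφ hχ hφ0 hφR hpair
  have c0 := sq_integral_momentum_mul_le hω hl hβ hT L (⟨0, by omega⟩ : Fin L) hφ0
  have hA' : ∫ x, x.2 ⟨L - 1, by omega⟩ * partialP (⟨L - 1, by omega⟩ : Fin L) φ x ∂((pinnedChain ω₂ lam β γ).gibbsMeasure L T) = 0 := by
    simp only [hfar, mul_zero, integral_zero]
  rw [hA', add_zero] at h1
  set A := ∫ x, x.2 ⟨0, by omega⟩ * partialP (⟨0, by omega⟩ : Fin L) φ x ∂((pinnedChain ω₂ lam β γ).gibbsMeasure L T) with hA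
  set E := ∫ x, (partialP (⟨0, by omega⟩ : Fin L) φ x) ^ 2 ∂((pinnedChain ω₂ lam β γ).gibbsMeasure L T) with hE
  have e : T ^ 2 = γ ^ 2 * A ^ 2 := by rw [← h1]; ring
  rw [div_le_iff₀ (by positivity)]
  nlinarith [e, c0, hT]

/-- **Two-ends obstruction, near end.**  If the `χ`-component of an admissible pair (`χ ∈ L²(μ_T)`) is EVEN under
momentum reversal `(q, p) ↦ (q, −p)` — e.g. `χ` does not depend on the momenta, or `χ = 0` — then
`‖∂_{p_0} φ‖²_{L²(μ_T)} ≥ T/γ²`: again no gain over the trivial pair.  (`p_0 ∂_{q_0}H` is reversal-odd, so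
`⟨χ, p_0 ∂_{q_0}H⟩ = 0`, and the source pairing gives `γ⟨p_0, ∂_{p_0}φ⟩ = T`.)  Hence a certificate improving on
`G_L ≥ 0` has a reversal-odd transport component correlated with the contact kinetic-energy production AND a
dissipative component loading the far bath. [folklore] -/
theorem certificate_noGain_of_reversalEven (hω : 0 < ω₂) (hl : 0 ≤ lam) (hβ : 0 ≤ β) (hγ : 0 < γ)
    (hT : 0 < T) {L : ℕ} (hL : 2 ≤ L) {φ χ : PhaseSpace L → ℝ} (hφ : ContDiff ℝ 2 φ) (hχ : ContDiff ℝ 2 χ)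
    (hφ0 : MemLp (partialP (⟨0, by omega⟩ : Fin L) φ) 2 ((pinnedChain ω₂ lam β γ).gibbsMeasure L T))
    (hφR : MemLp (partialP (⟨L - 1, by omega⟩ : Fin L) φ) 2 ((pinnedChain ω₂ lam β γ).gibbsMeasure L T))
    (hχ2 : MemLp χ 2 ((pinnedChain ω₂ lam β γ).gibbsMeasure L T)) (heven : ∀ x : PhaseSpace L, χ (x.1, -x.2) = χ x)
    (hpair : ∀ x, γ * bathOp L (OscillatorChain.bathWeight L) T φ x +
      liouvilleOp (pinnedChain ω₂ lam β γ) L χ x = -(kin L 0 x - T)) :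
    T / γ ^ 2 ≤ ∫ x, (partialP (⟨0, by omega⟩ : Fin L) φ x) ^ 2 ∂((pinnedChain ω₂ lam β γ).gibbsMeasure L T) := by
  have hL0 : 0 < L := by omega
  set i0 : Fin L := ⟨0, hL0⟩ with hi0
  have h2 := certificate_pairing_source hω hl hβ hT hL hφ hχ hφ0 hφR hχ2 hpair
  have c0 := sq_integral_momentum_mul_le hω hl hβ hT L i0 hφ0
  -- the odd pairing vanishes
  have hodd : ∫ x, χ x * (x.2 i0 * partialQ i0 ((pinnedChain ω₂ lam β γ).hamiltonian L) x) ∂((pinnedChain ω₂ lam β γ).gibbsMeasure L T) = 0 := by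
    rw [OscillatorChain.integral_gibbsMeasure]
    set F : PhaseSpace L → ℝ := fun x => χ x * (x.2 i0 * partialQ i0 ((pinnedChain ω₂ lam β γ).hamiltonian L) x) with hF
    have hrev : ∀ x, rev F x = -F x := fun x => by
      simp only [rev, hF, heven x, partialQ_hamiltonian_rev]
      simp only [Pi.neg_apply]
      ring
    have h := integral_rev_mul_gibbsDensity (pinnedChain ω₂ lam β γ) T F
    have h' : ∫ x, rev F x * (pinnedChain ω₂ lam β γ).gibbsDensity L T x = -∫ x, F x * (pinnedChain ω₂ lam β γ).gibbsDensity L T x := by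
      rw [← integral_neg]
      exact integral_congr_ae (ae_of_all _ fun x => by
        show rev F x * (pinnedChain ω₂ lam β γ).gibbsDensity L T x = -(F x * (pinnedChain ω₂ lam β γ).gibbsDensity L T x)
        rw [hrev x]; ring)
    have h0 : ∫ x, F x * (pinnedChain ω₂ lam β γ).gibbsDensity L T x = 0 := by linarith
    simp only [hF] at h0
    rw [h0, mul_zero]
  rw [hodd, sub_zero] at h2
  set A := ∫ x, x.2 i0 * partialP i0 φ x ∂((pinnedChain ω₂ lam β γ).gibbsMeasure L T) with hA
  set E := ∫ x, (partialP i0 φ x) ^ 2 ∂((pinnedChain ω₂ lam β γ).gibbsMeasure L T) with hE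
  have h1 : γ * A = T := by
    have : T * (γ * A) = T * T := by rw [← mul_assoc, mul_comm T γ, h2]; ring
    exact mul_left_cancel₀ hT.ne' this
  have e : T ^ 2 = γ ^ 2 * A ^ 2 := by rw [← h1]; ring
  rw [div_le_iff₀ (by positivity)]
  nlinarith [e, c0, hT]

/-- Registered helper sub-goal `helper_certificateNoGainOfFarFree` of stub `stub_transmissionGradientFloor`
(= `certificate_noGain_of_farFree` in closed form; line ForecastSensitivitySketch, crux stmt-AtomisticToContinuum-11749). [folklore] -/
theorem helper_certificateNoGainOfFarFree : ∀ {ω₂ lam β γ T : ℝ}, 0 < ω₂ → 0 ≤ lam → 0 ≤ β → 0 < γ → 0 < T → ∀ {L : ℕ} (hL : 2 ≤ L) {φ χ : PhaseSpace L → ℝ}, ContDiff ℝ 2 φ → ContDiff ℝ 2 χ → MemLp (partialP (⟨0, by omega⟩ : Fin L) φ) 2 ((pinnedChain ω₂ lam β γ).gibbsMeasure L T) → (∀ x, partialP (⟨L - 1, by omega⟩ : Fin L) φ x = 0) → (∀ x, γ * bathOp L (OscillatorChain.bathWeight L) T φ x + liouvilleOp (pinnedChain ω₂ lam β γ) L χ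 x = -(kin L 0 x - T)) → T / γ ^ 2 ≤ ∫ x, (partialP (⟨0, by omega⟩ : Fin L) φ x) ^ 2 ∂((pinnedChain ω₂ lam β γ).gibbsMeasure L T) :=
  @certificate_noGain_of_farFree

end Summit.AtomisticToContinuum.FouriersLaw.Cruxes.ConductanceLowerBound.ForecastSensitivity

end
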